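import Summits.CriticalPhenomena.PercolationContinuityZ3.Theorems.SahiMasterFamilyPointwiseTransferOrbit
import Summits.CriticalPhenomena.PercolationContinuityZ3.Theorems.SahiMasterFamilyPhiOrbitSeven
import Summits.CriticalPhenomena.PercolationContinuityZ3.Theorems.SahiMasterFamilyPointwiseSharedFaceVanishingLower
import Summits.CriticalPhenomena.PercolationContinuityZ3.Theorems.SahiMasterFamilyPointwiseSharedFaceVanishingAllOrders
import Summits.CriticalPhenomena.PercolationContinuityZ3.Theorems.SahiMasterFamilyPointwiseAbsorbing

/-!
# Pointwise (EQ-7): the order-seven principal cap, and the pointwise master conjecture / Sahi's `C_k` on the whole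
# (shared-)face-vanishing class for every `k ≤ 7`

Unit `prim-master-conj` (crux anchor stmt-CriticalPhenomena-4575, helper work), gen 14; memo
`run/shared/lean/prim/prim-l12/prim-master-conj/POINTWISE.md` §11–§15.  Seat P4 made `F(7)` a kernel theorem (`PhiCert.phiNonneg_seven`,
`…PhiOrbitSeven`: the exact 50-orbit certificate of kit j124604 checked by the orbit-basis reflection `PhiCert.phiNonneg_of_orbitPieces'` on the data
`normR_seven`, `reconD_seven`, `dataD_seven`).  By `…PointwiseTransferOrbit` the SAME data prove the zero transfer `PT 7`
(`PhiCert.phiTransfer_of_orbitPieces'`), and everything below is harvest — no new per-order mathematics: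
* `phiTransfer_seven` — `PT 7`; `principalCapPointwise_of_le_three` — the pointwise principal-cap hypothesis at orders `4,…,7`;
* **`sahiE_seven_ind_eq_zero_iff_of_principalCap`** (pointwise (EQ-7) on the principal-cap stratum), strict form;
* **`sahiE_seven_ind_eq_zero_iff_of_faceVanishing`, `sahiE_seven_ind_nonneg_of_faceVanishing`, `sahiE_seven_ind_pos_of_faceVanishing`** — on every
  face-vanishing 7-family (increasing, determined by `S`, all one-coordinate minors at `e ∈ S` in `Z_7`): Sahi's `C_7` at every `p`, and at every interior `p`
  `E_7(μ_p; 1_U) = 0 ↔ U ∈ Z_7`, `> 0` otherwise; uniform statements for every `k ≤ 7` (`…_of_faceVanishing_of_le_seven`);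
* SHARED-face-vanishing families (minors at coordinates essential to ≥ 2 members are zero flags), every `k ≤ 7`: `C_k` at every `p`
  (`sahiE_ind_nonneg_of_sharedFaceVanishing_of_le_seven'`, via the positivity-only induction `sahiE_ind_nonneg_of_shared_of_faceVanishing_all` run here
  with the face-vanishing statement as hypothesis), and at interior `p` the pointwise zero locus / strict positivity
  (`sahiE_ind_eq_zero_iff_of_sharedFaceVanishing_of_le_seven`, `…_pos_…`);
* DECREASING families and the GRAPH form (tuples of group separations `{X_j ↮ Y_j}` whose single-edge minors at shared edges are zero flags), `k ≤ 7`;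
* ABSORBING extensions: order EIGHT — eight increasing events one of which contains all the others, the other seven shared-face-vanishing: `C_8` and the
  pointwise zero locus (`sahiE_ind_eq_zero_iff_of_absorbing_sharedFaceVanishing_of_le_seven`).
HONEST FRAMING: `MasterFamilyEqIff 7`, `C_7` in general (Kahn's Conjecture 5 already at order 3) and `F(8)` remain OPEN.  Axioms standard. [this work]
-/

noncomputable section

open scoped Classical
open scoped unitInterval

namespace Summit.CriticalPhenomena.PercolationContinuityZ3.Theorems

open Finset Function
open Literature.Combinatorics.Sahi2008
open Literature.Probability.LatticeModels (isUpperSet_preimage_compl)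
open Literature.Probability.LatticeModels.Kahn2022 (Affects)
open Literature.Probability.Percolation (DeterminedBy determinedBy_iff)
open Literature.Probability.Percolation.DecisionTree (ind)
open SahiComb PrincipalCapBeta

namespace Pointwise

/-! ### 1. `PT 7` and the pointwise principal cap at orders `4, …, 7` -/

/-- **The zero transfer at order seven** (`PT 7`), read off P4's orbit-basis check of the `F(7)` certificate (kit j124604) by
`PhiCert.phiTransfer_of_orbitPieces'`. [compute j124604] [this work] -/
theorem phiTransfer_seven :
    ∀ β β' : Finset (Fin 7) → ℝ, β univ = 1 → β' univ = 1 →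
      (∀ B, 0 ≤ β B ∧ 0 ≤ β' B ∧ (β B = 0 → β' B = 0)) →
      (∀ B, 0 ≤ 1 - β B ∧ 0 ≤ 1 - β' B ∧ (1 - β B = 0 → 1 - β' B = 0)) →
      (∀ S A B : Finset (Fin 7), A ∪ B = S →
        0 ≤ β S - β A * β B ∧ 0 ≤ β' S - β' A * β' B ∧ (β S - β A * β B = 0 → β' S - β' A * β' B = 0)) →
      phiSet 7 β = 0 → phiSet 7 β' = 0 :=
  PhiCert.phiTransfer_of_orbitPieces' 6 2 (by norm_num) _ _ _ (by decide) PhiCert.dataD_seven PhiCert.normR_seven PhiCert.reconD_seven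

section Events

variable {ι : Type} [Fintype ι]

/-- **Pointwise (EQ-7) on the principal-cap stratum**: for seven increasing events whose common part is a principal up-set and `p` in the open cube,
`E_7(μ_p; 1_U) = 0 ↔ U ∈ Z_7`. [this work] -/
theorem sahiE_seven_ind_eq_zero_iff_of_principalCap (p : ι → unitInterval) (hp : ∀ e, (p e : ℝ) ∈ Set.Ioo (0 : ℝ) 1)
    (U : Fin 7 → Set (Set ι)) (hU : ∀ j, IsUpperSet (U j)) (c : Finset ι)
    (hpc : ∀ T : Set ι, (∀ j, T ∈ U j) ↔ (↑c : Set ι) ⊆ T) :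
    sahiE (bernoulliWeight p) 7 (fun j => ind (U j)) = 0 ↔ SuppZeroFlag 7 U :=
  sahiE_ind_eq_zero_iff_of_principalCap_of_phiTransfer (k := 6) phiTransfer_seven hp U hU c hpc

/-- Strict form: a principal-cap 7-family outside `Z_7` has `E_7(μ_p; 1_U) > 0` at every interior `p` (sign from P4's `C_7` there). [this work] -/
theorem sahiE_seven_ind_pos_of_principalCap (p : ι → unitInterval) (hp : ∀ e, (p e : ℝ) ∈ Set.Ioo (0 : ℝ) 1)
    (U : Fin 7 → Set (Set ι)) (hU : ∀ j, IsUpperSet (U j)) (c : Finset ι)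
    (hpc : ∀ T : Set ι, (∀ j, T ∈ U j) ↔ (↑c : Set ι) ⊆ T) (hZ : ¬ SuppZeroFlag 7 U) :
    0 < sahiE (bernoulliWeight p) 7 (fun j => ind (U j)) :=
  lt_of_le_of_ne (PhiCert.sahiE_seven_ind_nonneg_of_principalCap p U hU c hpc)
    (fun h0 => hZ ((sahiE_seven_ind_eq_zero_iff_of_principalCap p hp U hU c hpc).1 h0.symm))

end Events

/-- The pointwise principal-cap hypothesis holds at orders `4, 5, 6, 7`. [this work] -/
theorem principalCapPointwise_of_le_three (j : ℕ) (hj : j ≤ 3) (ι : Type) [Fintype ι] (q : ι → unitInterval)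
    (hq : ∀ e, (q e : ℝ) ∈ Set.Ioo (0 : ℝ) 1) (V : Fin (j + 4) → Set (Set ι)) (hV : ∀ i, IsUpperSet (V i)) (c : Finset ι)
    (hpc : ∀ T : Set ι, (∀ i, T ∈ V i) ↔ (↑c : Set ι) ⊆ T) (hz : sahiE (bernoulliWeight q) (j + 4) (fun i => ind (V i)) = 0) :
    SuppZeroFlag (j + 4) V := by
  rcases Nat.lt_or_ge j 3 with h | h
  · exact principalCapPointwise_of_le_two j (by omega) ι q hq V hV c hpc hz
  · obtain rfl : j = 3 := le_antisymm hj h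
    exact (sahiE_seven_ind_eq_zero_iff_of_principalCap q hq V hV c hpc).1 hz

/-! ### 2. Order seven on the face-vanishing class -/

section Events

variable {ι : Type} [Fintype ι]

/-- **Pointwise (EQ-7) on EVERY face-vanishing 7-family**: for seven increasing events determined by `S` all of whose one-coordinate minors at `e ∈ S`
lie in `Z_7`, and `p` in the open cube, `E_7(μ_p; 1_U) = 0 ↔ U ∈ Z_7`. [this work] -/
theorem sahiE_seven_ind_eq_zero_iff_of_faceVanishing (p : ι → unitInterval) (hp : ∀ e, (p e : ℝ) ∈ Set.Ioo (0 : ℝ) 1)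
    (U : Fin 7 → Set (Set ι)) (S : Finset ι) (hU : ∀ j, IsUpperSet (U j)) (hUS : ∀ j, DeterminedBy (U j) (↑S : Set ι))
    (hall : ∀ e ∈ S, ∀ b : Bool, SuppZeroFlag 7 (fun j => secAt e b (U j))) :
    sahiE (bernoulliWeight p) 7 (fun j => ind (U j)) = 0 ↔ SuppZeroFlag 7 U :=
  sahiE_ind_eq_zero_iff_of_faceVanishing_of_principalCapPointwise 3 principalCapPointwise_of_le_three ι p hp U S hU hUS hall

/-- **Sahi's `C_7` on every face-vanishing 7-family** (every `p ∈ [0,1]^ι`), from P4's `phiNonneg_of_le_seven`. [this work] -/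
theorem sahiE_seven_ind_nonneg_of_faceVanishing (p : ι → unitInterval) (U : Fin 7 → Set (Set ι)) (S : Finset ι)
    (hU : ∀ j, IsUpperSet (U j)) (hUS : ∀ j, DeterminedBy (U j) (↑S : Set ι))
    (hall : ∀ e ∈ S, ∀ b : Bool, SuppZeroFlag 7 (fun j => secAt e b (U j))) :
    0 ≤ sahiE (bernoulliWeight p) 7 (fun j => ind (U j)) :=
  sahiE_ind_nonneg_of_faceVanishing_of_phiNonneg 3 (fun j hj => PhiCert.phiNonneg_of_le_seven (by omega)) ι p U S hU hUS hall

/-- **Strict form**: a face-vanishing 7-family outside `Z_7` has `E_7(μ_p; 1_U) > 0` at every interior `p`. [this work] -/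
theorem sahiE_seven_ind_pos_of_faceVanishing (p : ι → unitInterval) (hp : ∀ e, (p e : ℝ) ∈ Set.Ioo (0 : ℝ) 1)
    (U : Fin 7 → Set (Set ι)) (S : Finset ι) (hU : ∀ j, IsUpperSet (U j)) (hUS : ∀ j, DeterminedBy (U j) (↑S : Set ι))
    (hall : ∀ e ∈ S, ∀ b : Bool, SuppZeroFlag 7 (fun j => secAt e b (U j))) (hZ : ¬ SuppZeroFlag 7 U) :
    0 < sahiE (bernoulliWeight p) 7 (fun j => ind (U j)) :=
  lt_of_le_of_ne (sahiE_seven_ind_nonneg_of_faceVanishing p U S hU hUS hall)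
    (fun h0 => hZ ((sahiE_seven_ind_eq_zero_iff_of_faceVanishing p hp U S hU hUS hall).1 h0.symm))

/-! ### 3. One statement for every order `k ≤ 7` on the face-vanishing class -/

/-- **Sahi's `C_k` on the face-vanishing class for every `k ≤ 7`.** [this work] -/
theorem sahiE_ind_nonneg_of_faceVanishing_of_le_seven {k : ℕ} (hk : k ≤ 7) (p : ι → unitInterval) (U : Fin k → Set (Set ι))
    (S : Finset ι) (hU : ∀ j, IsUpperSet (U j)) (hUS : ∀ j, DeterminedBy (U j) (↑S : Set ι))
    (hall : ∀ e ∈ S, ∀ b : Bool, SuppZeroFlag k (fun j => secAt e b (U j))) :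
    0 ≤ sahiE (bernoulliWeight p) k (fun j => ind (U j)) := by
  rcases Nat.lt_or_ge k 7 with h7 | h7
  · exact sahiE_ind_nonneg_of_faceVanishing_of_le_six (by omega) p U S hU hUS hall
  · obtain rfl : k = 7 := le_antisymm hk h7
    exact sahiE_seven_ind_nonneg_of_faceVanishing p U S hU hUS hall

/-- **The pointwise master conjecture on the face-vanishing class for every `k ≤ 7`**: at interior `p`, `E_k(μ_p; 1_U) = 0 ↔ U ∈ Z_k`. [this work] -/
theorem sahiE_ind_eq_zero_iff_of_faceVanishing_of_le_seven {k : ℕ} (hk : k ≤ 7) (p : ι → unitInterval)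
    (hp : ∀ e, (p e : ℝ) ∈ Set.Ioo (0 : ℝ) 1) (U : Fin k → Set (Set ι)) (S : Finset ι) (hU : ∀ j, IsUpperSet (U j))
    (hUS : ∀ j, DeterminedBy (U j) (↑S : Set ι)) (hall : ∀ e ∈ S, ∀ b : Bool, SuppZeroFlag k (fun j => secAt e b (U j))) :
    sahiE (bernoulliWeight p) k (fun j => ind (U j)) = 0 ↔ SuppZeroFlag k U := by
  rcases Nat.lt_or_ge k 7 with h7 | h7
  · exact sahiE_ind_eq_zero_iff_of_faceVanishing_of_le_six (by omega) p hp U S hU hUS hall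
  · obtain rfl : k = 7 := le_antisymm hk h7
    exact sahiE_seven_ind_eq_zero_iff_of_faceVanishing p hp U S hU hUS hall

/-- **Strict positivity off `Z_k` on the face-vanishing class, every `k ≤ 7`**, at interior `p`. [this work] -/
theorem sahiE_ind_pos_of_faceVanishing_of_le_seven {k : ℕ} (hk : k ≤ 7) (p : ι → unitInterval)
    (hp : ∀ e, (p e : ℝ) ∈ Set.Ioo (0 : ℝ) 1) (U : Fin k → Set (Set ι)) (S : Finset ι) (hU : ∀ j, IsUpperSet (U j))
    (hUS : ∀ j, DeterminedBy (U j) (↑S : Set ι)) (hall : ∀ e ∈ S, ∀ b : Bool, SuppZeroFlag k (fun j => secAt e b (U j)))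
    (hZ : ¬ SuppZeroFlag k U) : 0 < sahiE (bernoulliWeight p) k (fun j => ind (U j)) :=
  lt_of_le_of_ne (sahiE_ind_nonneg_of_faceVanishing_of_le_seven hk p U S hU hUS hall)
    (fun h0 => hZ ((sahiE_ind_eq_zero_iff_of_faceVanishing_of_le_seven hk p hp U S hU hUS hall).1 h0.symm))

/-- **`C_k` on DECREASING face-vanishing families, every `k ≤ 7`.** [this work] -/
theorem sahiE_ind_lower_nonneg_of_faceVanishing_of_le_seven {k : ℕ} (hk : k ≤ 7) (p : ι → unitInterval)
    (D : Fin k → Set (Set ι)) (S : Finset ι) (hD : ∀ j, IsLowerSet (D j)) (hDS : ∀ j, DeterminedBy (D j) (↑S : Set ι))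
    (hall : ∀ e ∈ S, ∀ b : Bool, SuppZeroFlag k (fun j => secAt e b (D j))) :
    0 ≤ sahiE (bernoulliWeight p) k (fun j => ind (D j)) := by
  rw [sahiE_ind_eq_sahiE_ind_preimage_compl]
  exact sahiE_ind_nonneg_of_faceVanishing_of_le_seven hk _ (fun j => compl ⁻¹' D j) S
    (fun j => isUpperSet_preimage_compl (hD j)) (fun j => (determinedBy_preimage_compl_iff (D j) _).2 (hDS j))
    (faceVanishing_preimage_compl D S hall)

/-- **Pointwise zero locus of DECREASING face-vanishing families, every `k ≤ 7`**, at interior `p`. [this work] -/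
theorem sahiE_ind_lower_eq_zero_iff_of_faceVanishing_of_le_seven {k : ℕ} (hk : k ≤ 7) (p : ι → unitInterval)
    (hp : ∀ e, (p e : ℝ) ∈ Set.Ioo (0 : ℝ) 1) (D : Fin k → Set (Set ι)) (S : Finset ι) (hD : ∀ j, IsLowerSet (D j))
    (hDS : ∀ j, DeterminedBy (D j) (↑S : Set ι)) (hall : ∀ e ∈ S, ∀ b : Bool, SuppZeroFlag k (fun j => secAt e b (D j))) :
    sahiE (bernoulliWeight p) k (fun j => ind (D j)) = 0 ↔ SuppZeroFlag k D := by
  rw [sahiE_ind_eq_sahiE_ind_preimage_compl, ← suppZeroFlag_preimage_compl_iff k D]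
  exact sahiE_ind_eq_zero_iff_of_faceVanishing_of_le_seven hk _ ((symm_mem_Ioo_iff p).2 hp) (fun j => compl ⁻¹' D j) S
    (fun j => isUpperSet_preimage_compl (hD j)) (fun j => (determinedBy_preimage_compl_iff (D j) _).2 (hDS j))
    (faceVanishing_preimage_compl D S hall)

/-! ### 4. Shared-face-vanishing families, every `k ≤ 7` -/

/-- **`C_k` for shared-face-vanishing families from the face-vanishing class, any order `k = n+2`, at EVERY `p`** — the positivity-only induction of
`…PointwiseSharedFaceVanishing` (`sahiE_ind_nonneg_of_sharedFaceVanishing_all`) with the face-vanishing statement as hypothesis. [this work] -/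
theorem sahiE_ind_nonneg_of_shared_of_faceVanishing_all {n : ℕ} (p : ι → unitInterval)
    (Hfv : ∀ (V : Fin (n + 2) → Set (Set ι)) (S : Finset ι), (∀ j, IsUpperSet (V j)) → (∀ j, DeterminedBy (V j) (↑S : Set ι)) →
      (∀ e ∈ S, ∀ b : Bool, SuppZeroFlag (n + 2) (fun j => secAt e b (V j))) → 0 ≤ sahiE (bernoulliWeight p) (n + 2) (fun j => ind (V j))) :
    ∀ (m : ℕ) (U : Fin (n + 2) → Set (Set ι)), (univ.biUnion fun j => esupp (U j)).card = m → (∀ j, IsUpperSet (U j)) →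
      (∀ e, (∃ i j, i ≠ j ∧ Affects (U i) e ∧ Affects (U j) e) → ∀ b : Bool, SuppZeroFlag (n + 2) (fun j => secAt e b (U j))) →
        0 ≤ sahiE (bernoulliWeight p) (n + 2) (fun j => ind (U j)) := by
  intro m
  induction m using Nat.strong_induction_on with
  | _ m ih =>
  intro U hm hU hsh
  by_cases hpriv : ∃ e ∈ (univ.biUnion fun j => esupp (U j)), ∃ i, ∀ j, j ≠ i → ¬ Affects (U j) e
  · obtain ⟨e, heT, i, hpi⟩ := hpriv
    have key : ∀ b : Bool, 0 ≤ sahiE (bernoulliWeight p) (n + 2) (fun j => ind (update U i (secAt e b (U i)) j)) := by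
      intro b
      refine ih _ ?_ (update U i (secAt e b (U i))) rfl (isUpperSet_update_secAt hU i e b) ?_
      · have hsub : (univ.biUnion fun j => esupp (update U i (secAt e b (U i)) j)) ⊆
            (univ.biUnion fun j => esupp (U j)).erase e := by
          intro f hf
          obtain ⟨j, -, hj⟩ := mem_biUnion.1 hf
          refine mem_erase.2 ⟨?_, mem_biUnion.2 ⟨j, mem_univ _, esupp_update_secAt_subset U hU i e b j hj⟩⟩
          rintro rfl
          exact not_mem_esupp_update_secAt U i f hpi b j hj
        rw [← hm]
        exact lt_of_le_of_lt (card_le_card hsub) (card_erase_lt_of_mem heT)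
      · rintro f ⟨i', j', hij, hi', hj'⟩ b'
        have hfe : f ≠ e := by
          rintro rfl
          exact not_mem_esupp_update_secAt U i f hpi b i' (mem_esupp.2 hi')
        have hshU : ∃ i j, i ≠ j ∧ Affects (U i) f ∧ Affects (U j) f :=
          ⟨i', j', hij, mem_esupp.1 (esupp_update_secAt_subset U hU i e b i' (mem_esupp.2 hi')),
            mem_esupp.1 (esupp_update_secAt_subset U hU i e b j' (mem_esupp.2 hj'))⟩
        rw [secAt_update_secAt_eq U i hfe b b']
        refine suppZeroFlag_update_secAt_of_private (fun j => secAt f b' (U j)) (fun j => isUpperSet_secAt f b' (hU j)) i e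
          (fun j hj hje => hpi j hj ?_) b (hsh f hshU b')
        exact mem_esupp.1 (mem_of_mem_erase (esupp_secAt_subset (hU j) f b' (mem_esupp.2 hje)))
    exact sahiE_ind_nonneg_of_private_sections p U hU i e hpi (key false) (key true)
  · push Not at hpriv
    set T : Finset ι := univ.biUnion fun j => esupp (U j) with hT
    have hUS : ∀ j, DeterminedBy (U j) (↑T : Set ι) := fun j =>
      (determinedBy_esupp (hU j)).mono (coe_subset.2 (subset_biUnion_of_mem (fun j => esupp (U j)) (mem_univ j)))
    have hall : ∀ e ∈ T, ∀ b : Bool, SuppZeroFlag (n + 2) (fun j => secAt e b (U j)) := by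
      intro e he b
      obtain ⟨j₀, -, hj₀⟩ := mem_biUnion.1 he
      obtain ⟨j₁, hj₁, hj₁e⟩ := hpriv e he j₀
      exact hsh e ⟨j₁, j₀, hj₁, hj₁e, mem_esupp.1 hj₀⟩ b
    exact Hfv U T hU hUS hall

/-- **Sahi's `C_k` for shared-face-vanishing families at EVERY `p ∈ [0,1]^ι`, every `k = n+2 ≤ 7`.** [this work] -/
theorem sahiE_ind_nonneg_of_sharedFaceVanishing_of_le_seven' {n : ℕ} (hn : n + 2 ≤ 7) (p : ι → unitInterval)
    (U : Fin (n + 2) → Set (Set ι)) (hU : ∀ j, IsUpperSet (U j))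
    (hsh : ∀ e, (∃ i j, i ≠ j ∧ Affects (U i) e ∧ Affects (U j) e) → ∀ b : Bool, SuppZeroFlag (n + 2) (fun j => secAt e b (U j))) :
    0 ≤ sahiE (bernoulliWeight p) (n + 2) (fun j => ind (U j)) :=
  sahiE_ind_nonneg_of_shared_of_faceVanishing_all p
    (fun V S hV hVS hall => sahiE_ind_nonneg_of_faceVanishing_of_le_seven hn p V S hV hVS hall) _ U rfl hU hsh

/-- **`C_k` and the pointwise zero locus for shared-face-vanishing families, every `k = n+2 ≤ 7`, at interior `p`.** [this work] -/
theorem sahiE_ind_nonneg_and_eq_zero_iff_of_sharedFaceVanishing_of_le_seven {n : ℕ} (hn : n + 2 ≤ 7) (p : ι → unitInterval)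
    (hp : ∀ e, (p e : ℝ) ∈ Set.Ioo (0 : ℝ) 1) (U : Fin (n + 2) → Set (Set ι)) (hU : ∀ j, IsUpperSet (U j))
    (hsh : ∀ e, (∃ i j, i ≠ j ∧ Affects (U i) e ∧ Affects (U j) e) → ∀ b : Bool, SuppZeroFlag (n + 2) (fun j => secAt e b (U j))) :
    0 ≤ sahiE (bernoulliWeight p) (n + 2) (fun j => ind (U j)) ∧
      (sahiE (bernoulliWeight p) (n + 2) (fun j => ind (U j)) = 0 ↔ SuppZeroFlag (n + 2) U) :=
  sahiE_ind_nonneg_and_eq_zero_iff_of_shared_of_faceVanishing p hp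
    (fun V S hV hVS hall => ⟨sahiE_ind_nonneg_of_faceVanishing_of_le_seven hn p V S hV hVS hall,
      sahiE_ind_eq_zero_iff_of_faceVanishing_of_le_seven hn p hp V S hV hVS hall⟩) _ U rfl hU hsh

/-- **The pointwise master conjecture for shared-face-vanishing families, every `k = n+2 ≤ 7`**: at interior `p`, `E_k(μ_p; 1_U) = 0 ↔ U ∈ Z_k`.
[this work] -/
theorem sahiE_ind_eq_zero_iff_of_sharedFaceVanishing_of_le_seven {n : ℕ} (hn : n + 2 ≤ 7) (p : ι → unitInterval)
    (hp : ∀ e, (p e : ℝ) ∈ Set.Ioo (0 : ℝ) 1) (U : Fin (n + 2) → Set (Set ι)) (hU : ∀ j, IsUpperSet (U j))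
    (hsh : ∀ e, (∃ i j, i ≠ j ∧ Affects (U i) e ∧ Affects (U j) e) → ∀ b : Bool, SuppZeroFlag (n + 2) (fun j => secAt e b (U j))) :
    sahiE (bernoulliWeight p) (n + 2) (fun j => ind (U j)) = 0 ↔ SuppZeroFlag (n + 2) U :=
  (sahiE_ind_nonneg_and_eq_zero_iff_of_sharedFaceVanishing_of_le_seven hn p hp U hU hsh).2

/-- **Strict positivity off `Z_k`** for shared-face-vanishing families, every `k = n+2 ≤ 7`, at interior `p`; at `k = 7`: seven increasing events whose
minors at every coordinate essential to at least two of them are zero flags have `E_7(μ_p;1_U) > 0` unless `U ∈ Z_7`. [this work] -/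
theorem sahiE_ind_pos_of_sharedFaceVanishing_of_le_seven {n : ℕ} (hn : n + 2 ≤ 7) (p : ι → unitInterval)
    (hp : ∀ e, (p e : ℝ) ∈ Set.Ioo (0 : ℝ) 1) (U : Fin (n + 2) → Set (Set ι)) (hU : ∀ j, IsUpperSet (U j))
    (hsh : ∀ e, (∃ i j, i ≠ j ∧ Affects (U i) e ∧ Affects (U j) e) → ∀ b : Bool, SuppZeroFlag (n + 2) (fun j => secAt e b (U j)))
    (hZ : ¬ SuppZeroFlag (n + 2) U) : 0 < sahiE (bernoulliWeight p) (n + 2) (fun j => ind (U j)) :=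
  lt_of_le_of_ne (sahiE_ind_nonneg_of_sharedFaceVanishing_of_le_seven' hn p U hU hsh)
    (fun h0 => hZ ((sahiE_ind_eq_zero_iff_of_sharedFaceVanishing_of_le_seven hn p hp U hU hsh).1 h0.symm))

/-- **DECREASING shared-face-vanishing families, every `k = n+2 ≤ 7`** (dependence read through sections: `D_j^{e←0} ≠ D_j^{e←1}`): `C_k` and the
pointwise zero locus at interior `p`. [this work] -/
theorem sahiE_ind_lower_nonneg_and_eq_zero_iff_of_sharedFaceVanishing_of_le_seven {n : ℕ} (hn : n + 2 ≤ 7) (p : ι → unitInterval)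
    (hp : ∀ e, (p e : ℝ) ∈ Set.Ioo (0 : ℝ) 1) (D : Fin (n + 2) → Set (Set ι)) (hD : ∀ j, IsLowerSet (D j))
    (hsh : ∀ e, (∃ i j, i ≠ j ∧ secAt e false (D i) ≠ secAt e true (D i) ∧ secAt e false (D j) ≠ secAt e true (D j)) →
      ∀ b : Bool, SuppZeroFlag (n + 2) (fun j => secAt e b (D j))) :
    0 ≤ sahiE (bernoulliWeight p) (n + 2) (fun j => ind (D j)) ∧
      (sahiE (bernoulliWeight p) (n + 2) (fun j => ind (D j)) = 0 ↔ SuppZeroFlag (n + 2) D) := by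
  rw [sahiE_ind_eq_sahiE_ind_preimage_compl, ← suppZeroFlag_preimage_compl_iff (n + 2) D]
  refine sahiE_ind_nonneg_and_eq_zero_iff_of_sharedFaceVanishing_of_le_seven hn _ ((symm_mem_Ioo_iff p).2 hp)
    (fun j => compl ⁻¹' D j) (fun j => isUpperSet_preimage_compl (hD j)) fun e ⟨i, j, hij, hi, hj⟩ b => ?_
  have hi' := (secAt_ne_iff_preimage_compl e (D i)).2 ((affects_iff_secAt_ne (isUpperSet_preimage_compl (hD i)) e).1 hi)
  have hj' := (secAt_ne_iff_preimage_compl e (D j)).2 ((affects_iff_secAt_ne (isUpperSet_preimage_compl (hD j)) e).1 hj)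
  have hZ := hsh e ⟨i, j, hij, hi', hj'⟩ (!b)
  have h := (suppZeroFlag_preimage_compl_iff (n + 2) (fun j => secAt e (!b) (D j))).2 hZ
  have hfam : (fun j => compl ⁻¹' secAt e (!b) (D j)) = fun j => secAt e b (compl ⁻¹' D j) := by
    funext j; rw [preimage_compl_secAt, Bool.not_not]
  rwa [hfam] at h

end Events

/-! ### 5. Graph form, every `k ≤ 7` -/

section Graph

open Literature.Probability.Percolation

variable {V : Type} [Fintype V]

/-- **Graph form, every `k = n+2 ≤ 7`**: for `k` group separations `{X_j ↮ Y_j}` on a finite graph whose single-edge minors at every edge on which at least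
two of them depend are zero flags: `E_k(μ_w;…) ≥ 0` at every interior edge-weight vector `w`, `= 0` iff the tuple is itself a zero flag. [this work] -/
theorem sahiE_groupSep_nonneg_and_eq_zero_iff_of_sharedFaceVanishing_of_le_seven {n : ℕ} (hn : n + 2 ≤ 7) (w : Sym2 V → unitInterval)
    (hw : ∀ e, (w e : ℝ) ∈ Set.Ioo (0 : ℝ) 1) (X Y : Fin (n + 2) → Set V)
    (hsh : ∀ e : Sym2 V, (∃ i j, i ≠ j ∧
        secAt e false {ω : BondConfig V | ∀ x ∈ X i, ∀ y ∈ Y i, ¬ (openGraph ω).Reachable x y} ≠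
          secAt e true {ω : BondConfig V | ∀ x ∈ X i, ∀ y ∈ Y i, ¬ (openGraph ω).Reachable x y} ∧
        secAt e false {ω : BondConfig V | ∀ x ∈ X j, ∀ y ∈ Y j, ¬ (openGraph ω).Reachable x y} ≠
          secAt e true {ω : BondConfig V | ∀ x ∈ X j, ∀ y ∈ Y j, ¬ (openGraph ω).Reachable x y}) →
      ∀ b : Bool, SuppZeroFlag (n + 2) (fun j => secAt e b {ω : BondConfig V | ∀ x ∈ X j, ∀ y ∈ Y j, ¬ (openGraph ω).Reachable x y})) :
    0 ≤ sahiE (bernoulliWeight w) (n + 2) (fun j => ind {ω : BondConfig V | ∀ x ∈ X j, ∀ y ∈ Y j, ¬ (openGraph ω).Reachable x y}) ∧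
      (sahiE (bernoulliWeight w) (n + 2) (fun j => ind {ω : BondConfig V | ∀ x ∈ X j, ∀ y ∈ Y j, ¬ (openGraph ω).Reachable x y}) = 0 ↔
        SuppZeroFlag (n + 2) fun j => {ω : BondConfig V | ∀ x ∈ X j, ∀ y ∈ Y j, ¬ (openGraph ω).Reachable x y}) :=
  sahiE_ind_lower_nonneg_and_eq_zero_iff_of_sharedFaceVanishing_of_le_seven hn w hw _ (fun j => isLowerSet_groupSep (X j) (Y j)) hsh

/-- **Graph form, face-vanishing, every `k ≤ 7`**: all single-edge minors zero flags ⟹ `E_k(μ_w;…) ≥ 0` for EVERY weight vector `w`. [this work] -/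
theorem sahiE_groupSep_nonneg_of_faceVanishing_of_le_seven {k : ℕ} (hk : k ≤ 7) (w : Sym2 V → unitInterval) (X Y : Fin k → Set V)
    (hall : ∀ (e : Sym2 V) (b : Bool), SuppZeroFlag k (fun j =>
      secAt e b {ω : BondConfig V | ∀ x ∈ X j, ∀ y ∈ Y j, ¬ (openGraph ω).Reachable x y})) :
    0 ≤ sahiE (bernoulliWeight w) k (fun j => ind {ω : BondConfig V | ∀ x ∈ X j, ∀ y ∈ Y j, ¬ (openGraph ω).Reachable x y}) :=
  sahiE_ind_lower_nonneg_of_faceVanishing_of_le_seven hk w _ univ (fun j => isLowerSet_groupSep (X j) (Y j))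
    (fun j => by rw [coe_univ, determinedBy_iff]; intro ω ω' h; rw [Set.inter_univ, Set.inter_univ] at h; rw [h])
    (fun e _ b => hall e b)

/-- **Graph form, face-vanishing, pointwise, every `k ≤ 7`**: at interior `w`, `E_k = 0` iff the tuple of separations is a zero flag. [this work] -/
theorem sahiE_groupSep_eq_zero_iff_of_faceVanishing_of_le_seven {k : ℕ} (hk : k ≤ 7) (w : Sym2 V → unitInterval)
    (hw : ∀ e, (w e : ℝ) ∈ Set.Ioo (0 : ℝ) 1) (X Y : Fin k → Set V)
    (hall : ∀ (e : Sym2 V) (b : Bool), SuppZeroFlag k (fun j =>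
      secAt e b {ω : BondConfig V | ∀ x ∈ X j, ∀ y ∈ Y j, ¬ (openGraph ω).Reachable x y})) :
    sahiE (bernoulliWeight w) k (fun j => ind {ω : BondConfig V | ∀ x ∈ X j, ∀ y ∈ Y j, ¬ (openGraph ω).Reachable x y}) = 0 ↔
      SuppZeroFlag k fun j => {ω : BondConfig V | ∀ x ∈ X j, ∀ y ∈ Y j, ¬ (openGraph ω).Reachable x y} :=
  sahiE_ind_lower_eq_zero_iff_of_faceVanishing_of_le_seven hk w hw _ univ (fun j => isLowerSet_groupSep (X j) (Y j))
    (fun j => by rw [coe_univ, determinedBy_iff]; intro ω ω' h; rw [Set.inter_univ, Set.inter_univ] at h; rw [h])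
    (fun e _ b => hall e b)

end Graph

/-! ### 6. Absorbing extensions: order EIGHT -/

section Absorbing

variable {ι : Type} [Fintype ι]

/-- **`C_{k+1}` for an absorbing extension of a shared-face-vanishing `k`-family, every `k = n+2 ≤ 7`** (so up to EIGHT events), every `p`. [this work] -/
theorem sahiE_ind_nonneg_of_absorbing_sharedFaceVanishing_of_le_seven {n : ℕ} (hn : n + 2 ≤ 7) (p : ι → unitInterval)
    (U : Fin (n + 3) → Set (Set ι)) (hU : ∀ i, IsUpperSet (U i)) (j : Fin (n + 3)) (habs : ∀ l, l ≠ j → U l ⊆ U j)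
    (hsh : ∀ e, (∃ i i', i ≠ i' ∧ Affects (U (j.succAbove i)) e ∧ Affects (U (j.succAbove i')) e) →
      ∀ b : Bool, SuppZeroFlag (n + 2) (fun i => secAt e b (U (j.succAbove i)))) :
    0 ≤ sahiE (bernoulliWeight p) (n + 3) (fun i => ind (U i)) :=
  (sahiE_ind_nonneg_iff_erase_of_absorbing p U j habs).2
    (sahiE_ind_nonneg_of_sharedFaceVanishing_of_le_seven' hn p (fun i => U (j.succAbove i)) (fun _ => hU _) hsh)

/-- **Pointwise master conjecture for an absorbing extension of a shared-face-vanishing `k`-family, every `k = n+2 ≤ 7`** — in particular for EIGHT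
increasing events `U_0,…,U_7` with `U_7 ⊇ U_l` and `(U_0,…,U_6)` shared-face-vanishing: at interior `p`, `E_8(μ_p; 1_U) = 0 ↔ U ∈ Z_8`. [this work] -/
theorem sahiE_ind_eq_zero_iff_of_absorbing_sharedFaceVanishing_of_le_seven {n : ℕ} (hn : n + 2 ≤ 7) (p : ι → unitInterval)
    (hp : ∀ e, (p e : ℝ) ∈ Set.Ioo (0 : ℝ) 1) (U : Fin (n + 3) → Set (Set ι)) (hU : ∀ i, IsUpperSet (U i)) (j : Fin (n + 3))
    (habs : ∀ l, l ≠ j → U l ⊆ U j)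
    (hsh : ∀ e, (∃ i i', i ≠ i' ∧ Affects (U (j.succAbove i)) e ∧ Affects (U (j.succAbove i')) e) →
      ∀ b : Bool, SuppZeroFlag (n + 2) (fun i => secAt e b (U (j.succAbove i)))) :
    sahiE (bernoulliWeight p) (n + 3) (fun i => ind (U i)) = 0 ↔ SuppZeroFlag (n + 3) U :=
  (pointwise_iff_erase_of_absorbing p U hU j habs).2
    (sahiE_ind_eq_zero_iff_of_sharedFaceVanishing_of_le_seven hn p hp (fun i => U (j.succAbove i)) (fun _ => hU _) hsh)

/-- Strict form: such an extension outside `Z_{k+1}` has `E_{k+1}(μ_p; 1_U) > 0` at every interior `p` (`k ≤ 7`). [this work] -/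
theorem sahiE_ind_pos_of_absorbing_sharedFaceVanishing_of_le_seven {n : ℕ} (hn : n + 2 ≤ 7) (p : ι → unitInterval)
    (hp : ∀ e, (p e : ℝ) ∈ Set.Ioo (0 : ℝ) 1) (U : Fin (n + 3) → Set (Set ι)) (hU : ∀ i, IsUpperSet (U i)) (j : Fin (n + 3))
    (habs : ∀ l, l ≠ j → U l ⊆ U j)
    (hsh : ∀ e, (∃ i i', i ≠ i' ∧ Affects (U (j.succAbove i)) e ∧ Affects (U (j.succAbove i')) e) →
      ∀ b : Bool, SuppZeroFlag (n + 2) (fun i => secAt e b (U (j.succAbove i)))) (hZ : ¬ SuppZeroFlag (n + 3) U) :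
    0 < sahiE (bernoulliWeight p) (n + 3) (fun i => ind (U i)) :=
  lt_of_le_of_ne (sahiE_ind_nonneg_of_absorbing_sharedFaceVanishing_of_le_seven hn p U hU j habs hsh)
    (fun h0 => hZ ((sahiE_ind_eq_zero_iff_of_absorbing_sharedFaceVanishing_of_le_seven hn p hp U hU j habs hsh).1 h0.symm))

end Absorbing

end Pointwise

end Summit.CriticalPhenomena.PercolationContinuityZ3.Theorems
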